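import Summits.QuantumFields.BalabanUV.Beta.EriceFlowEnclosureB12AsPrintedHistoryContagionShiftFlowPicardPin

/-!
# Beta / EriceFlowEnclosureB12AsPrintedHistoryContagionShiftFlowZeroTangent — ASYMPTOTIC FREEDOM IS CONTAGIOUS, part 66: THE LINEAR MEMORY EQUATION.  Gen 41 (parts
# 54–65) gave the continuous renormalization group of the flow with memory an infinitesimal generator at ALMOST EVERY scale with NO differentiability hypothesis on the
# memory functional, and showed «almost every» optimal on the class «memory profile + value at zero» (part 62's kink).  Parts 66–73 are the other half of the
# dichotomy: a functional that is C¹ ALONG THE HISTORY (part 68's def-free hypothesis shape: a gradient with the memory profile, a uniform first-order remainder) has a C¹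
# Λ-coordinate and a Gell-Mann–Low equation at EVERY scale with a CONTINUOUS β-function (parts 69–70).  The engine is this file, ABSTRACT and B-free: the LINEAR MEMORY
# EQUATION **`W_k = s_k − Σ_{p<k} Σ_j c_{p,j}·v_{p+1+j}·W_{p+1+j}`** — the shape of the pin-derivative of `1∕h_k²` (part 68: `c_{p,j}` = the gradient of B at the tail
# `(h_{p+1+i})_i`, `v_q = h_q³∕2` the chart-to-coupling Jacobian, `s ≡ 1`), and of the difference quotients of two solutions (`v_q = h_q²h̃_q²∕(h_q + h̃_q)`, `s = 1 +`
# remainder).  Under `|c_{p,j}| ≤ C_mθ^j` (fading memory) and `|v_q| ≤ w_q∕2` for an ANTITONE weight with partial sums `≤ S` (the AF weights `(1∕(4f²) + (β*∕4)q)^{−3∕2}`,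
# `S = 8f³ + 16f∕β*` — node U2's `sum_profWeights_le`, part 14's kernel), the operator is a **SUP-NORM CONTRACTION OVER ALL SCALES with constant `C_mS∕(2(1−θ))`** (§108) — no
# scale weights: asymptotic freedom makes the Jacobian summable along the trajectory.  Hence (§109): a bounded solution EXISTS (Picard iteration from 0, scale-wise limits,
# Tannery), is UNIQUE, and depends LIPSCHITZ-continuously on (c, v, s) (`fixedPoint_perturb` — the one estimate parts 68–69 use three times: difference quotients
# against the tangent flow, the tangent flow at two pins, and two gradients); part 67 adds its ULTRAVIOLET LIMIT `W_∞ = lim_k W_k` and the AF weights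
# (β-flow team, prover 1, unit `b2b-balaban-beta-bflow-p1`, gen 42; ROW AP-I·Uc × NODE U2)

HONEST FRAMING (page 1 of everything the β sub-cell writes): discharging `BetaPertH` makes Bałaban's UV stability UNCONDITIONAL — a
real constructive-QFT result; it is NOT the continuum limit and NOT the Clay problem.  HONEST DEPENDENCY (cell reorg 2026-08-19,
verbatim): «continuum YM on T⁴ ⇐ BetaPertH ∧ nine spine estimates (0/9 proved); BetaPertH ⇐ (D1) ∧ (D4) ∧ CAP+tail; G-an2-4 gates
asym, D1 and NE2/3/4.»  THIS MODULE DISCHARGES NOTHING: [folklore] real analysis (geometric rows, finite sums, Picard iteration of an affine sup-norm contraction,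
Tannery's theorem, Cauchy sequences) over node U2's profile letters `T4CouplingMatching.{prof, sprof, sum_profWeights_le, inv_cube_le_telescope}` and its closing lemma
`T4BetaFlowWellPosed.le_of_affine_contraction`, consumed BY NAME; NO functional B appears.  The objects are ours: [I] = T. Bałaban, Commun. Math. Phys. **109** (1987)
[Balaban1987RG1] prints the recursion (0.20) p. 256 and Theorem 2 (0.31) p. 259 (STATED WITHOUT PROOF) and says (p. 298) only that β_j depends on the preceding
couplings; a derivative of the coupling flow in its initial datum is printed nowhere in [I] (Erice 1985 (3.61)–(3.62) p. 250 differentiate the CONTINUUM coupling in the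
scale, not in the datum).  Nothing of Bałaban's β is asserted.

WHAT THIS FILE PROVES (0 sorry, 0 def): §107 `row_summable_abs_le`, `kernel_abs_le`, `kernel_tail_abs_le`; §108 `abs_term_le`, `term_summable`, **`map_abs_le`**,
**`map_sub_abs_le`** (the contraction), `iterate_abs_le`, `iterate_step_abs_le`, `iterate_tendsto`; §109 **`fixedPoint_exists`**, **`fixedPoint_perturb`**,
`fixedPoint_unique`.  NOT CLAIMED: the ultraviolet limit and the AF weights (part 67); anything about a functional B (part 68); anything about Bałaban's β;
`BetaPertH`; the continuum limit of the measures; Clay.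
-/

namespace Summit.QuantumFields.BalabanUV.Beta.EriceFlowEnclosureB12AsPrintedHistoryContagionShiftFlowZeroTangent

open Finset Filter Topology
open Literature.MathematicalPhysics.QuantumFieldTheory.Balaban1983to89
open Literature.MathematicalPhysics.QuantumFieldTheory.Balaban1983to89.T4CouplingMatching (prof sprof sprof_pos sprof_sq prof_pos sprof_zero sum_profWeights_le
  inv_cube_le_telescope sprof_sq_diff)
open Literature.MathematicalPhysics.QuantumFieldTheory.Balaban1983to89.T4BetaFlowWellPosed (le_of_affine_contraction)
open Summit.QuantumFields.BalabanUV.Beta.EriceFlowEnclosureB12AsPrintedHistoryContagion (sprof_le_sprof)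

noncomputable section

/-! ## §107 The fading row against an antitone weight with bounded partial sums -/

/-- **THE ROW.**  `|F_j| ≤ C_m θ^j · w_{p+1+j} · A` with `0 ≤ θ < 1`, w antitone, `A ≥ 0` ⟹ F is summable and `|Σ_j F_j| ≤ C_m w_{p+1} A ∕ (1 − θ)` (the whole fading
row is charged to its YOUNGEST weight). [folklore] -/
theorem row_summable_abs_le {Cm θ A : ℝ} {w : ℕ → ℝ} {F : ℕ → ℝ} (hθ0 : 0 ≤ θ) (hθ1 : θ < 1)
    (hwanti : ∀ {a b : ℕ}, a ≤ b → w b ≤ w a) (hA : 0 ≤ A) (hCm : 0 ≤ Cm) (p : ℕ)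
    (hF : ∀ j, |F j| ≤ Cm * θ ^ j * (w (p + 1 + j) * A)) :
    Summable F ∧ |∑' j, F j| ≤ Cm * (w (p + 1) * A) / (1 - θ) := by
  have hg : Summable fun j : ℕ => (Cm * (w (p + 1) * A)) * θ ^ j := (summable_geometric_of_lt_one hθ0 hθ1).mul_left _
  have hle : ∀ j, |F j| ≤ (Cm * (w (p + 1) * A)) * θ ^ j := fun j =>
    calc |F j| ≤ Cm * θ ^ j * (w (p + 1 + j) * A) := hF j
      _ ≤ Cm * θ ^ j * (w (p + 1) * A) :=
          mul_le_mul_of_nonneg_left (mul_le_mul_of_nonneg_right (hwanti (by omega)) hA) (by positivity)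
      _ = (Cm * (w (p + 1) * A)) * θ ^ j := by ring
  have hs : Summable F := Summable.of_norm_bounded hg fun j => by rw [Real.norm_eq_abs]; exact hle j
  refine ⟨hs, ?_⟩
  have hsa : Summable fun j => |F j| := hs.abs
  have hsn : Summable fun j => ‖F j‖ := by simpa only [Real.norm_eq_abs] using hsa
  calc |∑' j, F j| ≤ ∑' j, |F j| := by
        have h := norm_tsum_le_tsum_norm hsn
        simpa only [Real.norm_eq_abs] using h
    _ ≤ ∑' j : ℕ, (Cm * (w (p + 1) * A)) * θ ^ j := hsa.tsum_le_tsum hle hg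
    _ = (Cm * (w (p + 1) * A)) * ∑' j : ℕ, θ ^ j := tsum_mul_left
    _ = Cm * (w (p + 1) * A) / (1 - θ) := by rw [tsum_geometric_of_lt_one hθ0 hθ1, div_eq_mul_inv]

/-- **THE KERNEL, UNIFORM IN THE SCALE.**  Rows as in `row_summable_abs_le` for every p, weights `w ≥ 0` with partial sums `Σ_{q≤m} w_q ≤ S` ⟹
`|Σ_{p<k} Σ_j F_{p,j}| ≤ C_m S A ∕ (1 − θ)` for EVERY k. [folklore] -/
theorem kernel_abs_le {Cm θ A S : ℝ} {w : ℕ → ℝ} {F : ℕ → ℕ → ℝ} (hθ0 : 0 ≤ θ) (hθ1 : θ < 1)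
    (hw0 : ∀ q, 0 ≤ w q) (hwanti : ∀ {a b : ℕ}, a ≤ b → w b ≤ w a) (hwS : ∀ m, ∑ q ∈ range (m + 1), w q ≤ S)
    (hA : 0 ≤ A) (hCm : 0 ≤ Cm) (hF : ∀ p j, |F p j| ≤ Cm * θ ^ j * (w (p + 1 + j) * A)) (k : ℕ) :
    |∑ p ∈ range k, ∑' j, F p j| ≤ Cm * S * A / (1 - θ) := by
  have h1θ : 0 < 1 - θ := by linarith
  have hW : ∑ p ∈ range k, w (p + 1) ≤ S := by
    have h1 : ∑ p ∈ range k, w (p + 1) ≤ ∑ q ∈ range (k + 1), w q := by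
      rw [Finset.sum_range_succ']; linarith [hw0 0]
    exact h1.trans (hwS k)
  calc |∑ p ∈ range k, ∑' j, F p j| ≤ ∑ p ∈ range k, |∑' j, F p j| := Finset.abs_sum_le_sum_abs _ _
    _ ≤ ∑ p ∈ range k, Cm * (w (p + 1) * A) / (1 - θ) :=
        Finset.sum_le_sum fun p _ => (row_summable_abs_le hθ0 hθ1 hwanti hA hCm p (hF p)).2
    _ = Cm * A / (1 - θ) * ∑ p ∈ range k, w (p + 1) := by
        rw [Finset.mul_sum]; refine Finset.sum_congr rfl fun p _ => ?_; ring
    _ ≤ Cm * A / (1 - θ) * S := mul_le_mul_of_nonneg_left hW (by positivity)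
    _ = Cm * S * A / (1 - θ) := by ring

/-- **THE KERNEL BETWEEN TWO SCALES**: `|Σ_{n≤p<k} Σ_j F_{p,j}| ≤ (C_m A ∕ (1 − θ))·Σ_{n≤p<k} w_{p+1}` — the weight TAIL controls the ultraviolet increments. [folklore] -/
theorem kernel_tail_abs_le {Cm θ A : ℝ} {w : ℕ → ℝ} {F : ℕ → ℕ → ℝ} (hθ0 : 0 ≤ θ) (hθ1 : θ < 1)
    (hwanti : ∀ {a b : ℕ}, a ≤ b → w b ≤ w a) (hA : 0 ≤ A) (hCm : 0 ≤ Cm)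
    (hF : ∀ p j, |F p j| ≤ Cm * θ ^ j * (w (p + 1 + j) * A)) (n k : ℕ) :
    |∑ p ∈ Ico n k, ∑' j, F p j| ≤ Cm * A / (1 - θ) * ∑ p ∈ Ico n k, w (p + 1) := by
  calc |∑ p ∈ Ico n k, ∑' j, F p j| ≤ ∑ p ∈ Ico n k, |∑' j, F p j| := Finset.abs_sum_le_sum_abs _ _
    _ ≤ ∑ p ∈ Ico n k, Cm * (w (p + 1) * A) / (1 - θ) :=
        Finset.sum_le_sum fun p _ => (row_summable_abs_le hθ0 hθ1 hwanti hA hCm p (hF p)).2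
    _ = Cm * A / (1 - θ) * ∑ p ∈ Ico n k, w (p + 1) := by
        rw [Finset.mul_sum]; refine Finset.sum_congr rfl fun p _ => ?_; ring

/-! ## §108 The affine operator `(T W)_k = s_k − Σ_{p<k} Σ_j c_{p,j} v_{p+1+j} W_{p+1+j}`: bounds, the contraction, Picard iteration -/

/-- One term: `|c_{p,j}| ≤ C_mθ^j`, `|v_q| ≤ w_q∕2`, `|W_q| ≤ M` ⟹ `|c_{p,j} v_{p+1+j} W_{p+1+j}| ≤ C_mθ^j · w_{p+1+j} · (M∕2)`. [folklore] -/
theorem abs_term_le {Cm θ M : ℝ} {w : ℕ → ℝ} {c : ℕ → ℕ → ℝ} {v W : ℕ → ℝ} (hCm : 0 ≤ Cm) (hθ0 : 0 ≤ θ)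
    (hc : ∀ p j, |c p j| ≤ Cm * θ ^ j) (hv : ∀ q, |v q| ≤ w q / 2) (hW : ∀ q, |W q| ≤ M) (p j : ℕ) :
    |c p j * v (p + 1 + j) * W (p + 1 + j)| ≤ Cm * θ ^ j * (w (p + 1 + j) * (M / 2)) := by
  have hM : 0 ≤ M := (abs_nonneg _).trans (hW 0)
  have hw : 0 ≤ w (p + 1 + j) / 2 := le_trans (abs_nonneg _) (hv _)
  rw [abs_mul, abs_mul]
  calc |c p j| * |v (p + 1 + j)| * |W (p + 1 + j)| ≤ Cm * θ ^ j * (w (p + 1 + j) / 2) * M :=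
        mul_le_mul (mul_le_mul (hc p j) (hv _) (abs_nonneg _) (by positivity)) (hW _) (abs_nonneg _)
          (mul_nonneg (by positivity) hw)
    _ = Cm * θ ^ j * (w (p + 1 + j) * (M / 2)) := by ring

/-- Each row of the operator applied to a bounded sequence is summable. [folklore] -/
theorem term_summable {Cm θ M : ℝ} {w : ℕ → ℝ} {c : ℕ → ℕ → ℝ} {v W : ℕ → ℝ} (hCm : 0 ≤ Cm) (hθ0 : 0 ≤ θ) (hθ1 : θ < 1)
    (hwanti : ∀ {a b : ℕ}, a ≤ b → w b ≤ w a)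
    (hc : ∀ p j, |c p j| ≤ Cm * θ ^ j) (hv : ∀ q, |v q| ≤ w q / 2) (hW : ∀ q, |W q| ≤ M) (p : ℕ) :
    Summable fun j => c p j * v (p + 1 + j) * W (p + 1 + j) :=
  have hM : 0 ≤ M := (abs_nonneg _).trans (hW 0)
  (row_summable_abs_le hθ0 hθ1 hwanti (by positivity) hCm p (abs_term_le hCm hθ0 hc hv hW p)).1

/-- **THE OPERATOR PRESERVES BOUNDEDNESS**: `|(T W)_k| ≤ |s_k| + (C_mS∕(2(1−θ)))·M` for `|W| ≤ M`. [folklore] -/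
theorem map_abs_le {Cm θ S M : ℝ} {w : ℕ → ℝ} {c : ℕ → ℕ → ℝ} {v s W : ℕ → ℝ} (hCm : 0 ≤ Cm) (hθ0 : 0 ≤ θ) (hθ1 : θ < 1)
    (hw0 : ∀ q, 0 ≤ w q) (hwanti : ∀ {a b : ℕ}, a ≤ b → w b ≤ w a) (hwS : ∀ m, ∑ q ∈ range (m + 1), w q ≤ S)
    (hc : ∀ p j, |c p j| ≤ Cm * θ ^ j) (hv : ∀ q, |v q| ≤ w q / 2) (hW : ∀ q, |W q| ≤ M) (k : ℕ) :
    |s k - ∑ p ∈ range k, ∑' j, c p j * v (p + 1 + j) * W (p + 1 + j)| ≤ |s k| + Cm * S / (2 * (1 - θ)) * M := by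
  have hM : 0 ≤ M := (abs_nonneg _).trans (hW 0)
  have hk := kernel_abs_le hθ0 hθ1 hw0 hwanti hwS (by positivity : 0 ≤ M / 2) hCm (abs_term_le hCm hθ0 hc hv hW) k
  have e : Cm * S * (M / 2) / (1 - θ) = Cm * S / (2 * (1 - θ)) * M := by
    rw [div_mul_eq_mul_div, div_eq_div_iff (by linarith) (by nlinarith)]
    ring
  calc |s k - ∑ p ∈ range k, ∑' j, c p j * v (p + 1 + j) * W (p + 1 + j)|
      ≤ |s k| + |∑ p ∈ range k, ∑' j, c p j * v (p + 1 + j) * W (p + 1 + j)| := abs_sub _ _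
    _ ≤ |s k| + Cm * S / (2 * (1 - θ)) * M := by rw [← e]; linarith

/-- **THE CONTRACTION.**  Two bounded sequences δ-close at every scale have images `(C_mS∕(2(1−θ)))·δ`-close at every scale — a SUP-NORM contraction over ALL scales
as soon as `C_mS < 2(1−θ)`; no scale weights are needed because the Jacobian weights w are summable along an asymptotically free trajectory. [folklore] -/
theorem map_sub_abs_le {Cm θ S M M' δ : ℝ} {w : ℕ → ℝ} {c : ℕ → ℕ → ℝ} {v s W W' : ℕ → ℝ} (hCm : 0 ≤ Cm) (hθ0 : 0 ≤ θ) (hθ1 : θ < 1)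
    (hw0 : ∀ q, 0 ≤ w q) (hwanti : ∀ {a b : ℕ}, a ≤ b → w b ≤ w a) (hwS : ∀ m, ∑ q ∈ range (m + 1), w q ≤ S)
    (hc : ∀ p j, |c p j| ≤ Cm * θ ^ j) (hv : ∀ q, |v q| ≤ w q / 2) (hW : ∀ q, |W q| ≤ M) (hW' : ∀ q, |W' q| ≤ M')
    (hd : ∀ q, |W q - W' q| ≤ δ) (k : ℕ) :
    |(s k - ∑ p ∈ range k, ∑' j, c p j * v (p + 1 + j) * W (p + 1 + j))
      - (s k - ∑ p ∈ range k, ∑' j, c p j * v (p + 1 + j) * W' (p + 1 + j))| ≤ Cm * S / (2 * (1 - θ)) * δ := by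
  have hδ : 0 ≤ δ := (abs_nonneg _).trans (hd 0)
  have hrow : ∀ p, ∑' j, c p j * v (p + 1 + j) * W (p + 1 + j) - ∑' j, c p j * v (p + 1 + j) * W' (p + 1 + j)
      = ∑' j, c p j * v (p + 1 + j) * (W (p + 1 + j) - W' (p + 1 + j)) := by
    intro p
    rw [← (term_summable hCm hθ0 hθ1 hwanti hc hv hW p).tsum_sub (term_summable hCm hθ0 hθ1 hwanti hc hv hW' p)]
    exact tsum_congr fun j => by ring
  have hF : ∀ p j, |c p j * v (p + 1 + j) * (W (p + 1 + j) - W' (p + 1 + j))| ≤ Cm * θ ^ j * (w (p + 1 + j) * (δ / 2)) :=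
    abs_term_le (W := fun q => W q - W' q) hCm hθ0 hc hv hd
  have hk := kernel_abs_le hθ0 hθ1 hw0 hwanti hwS (by positivity : 0 ≤ δ / 2) hCm hF k
  have e : Cm * S * (δ / 2) / (1 - θ) = Cm * S / (2 * (1 - θ)) * δ := by
    rw [div_mul_eq_mul_div, div_eq_div_iff (by linarith) (by nlinarith)]
    ring
  have hsum : ∑ p ∈ range k, ∑' j, c p j * v (p + 1 + j) * W (p + 1 + j) - ∑ p ∈ range k, ∑' j, c p j * v (p + 1 + j) * W' (p + 1 + j)
      = ∑ p ∈ range k, ∑' j, c p j * v (p + 1 + j) * (W (p + 1 + j) - W' (p + 1 + j)) := by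
    rw [← Finset.sum_sub_distrib]
    exact Finset.sum_congr rfl fun p _ => hrow p
  rw [show (s k - ∑ p ∈ range k, ∑' j, c p j * v (p + 1 + j) * W (p + 1 + j))
      - (s k - ∑ p ∈ range k, ∑' j, c p j * v (p + 1 + j) * W' (p + 1 + j))
      = -(∑ p ∈ range k, ∑' j, c p j * v (p + 1 + j) * W (p + 1 + j)
          - ∑ p ∈ range k, ∑' j, c p j * v (p + 1 + j) * W' (p + 1 + j)) by ring, hsum, abs_neg, ← e]
  exact hk

/-- THE PICARD ITERATES FROM ZERO STAY BOUNDED: `|s| ≤ σ`, `C_mS∕(2(1−θ)) ≤ 1∕2` ⟹ `|(T^n 0)_k| ≤ 2σ` for all n, k. [folklore] -/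
theorem iterate_abs_le {Cm θ S σ : ℝ} {w : ℕ → ℝ} {c : ℕ → ℕ → ℝ} {v s : ℕ → ℝ} (hCm : 0 ≤ Cm) (hθ0 : 0 ≤ θ) (hθ1 : θ < 1)
    (hw0 : ∀ q, 0 ≤ w q) (hwanti : ∀ {a b : ℕ}, a ≤ b → w b ≤ w a) (hwS : ∀ m, ∑ q ∈ range (m + 1), w q ≤ S)
    (hc : ∀ p j, |c p j| ≤ Cm * θ ^ j) (hv : ∀ q, |v q| ≤ w q / 2) (hs : ∀ k, |s k| ≤ σ) (hq : Cm * S / (2 * (1 - θ)) ≤ 1 / 2) :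
    ∀ n k, |((fun W : ℕ → ℝ => fun k => s k - ∑ p ∈ range k, ∑' j, c p j * v (p + 1 + j) * W (p + 1 + j))^[n] (fun _ => 0) k)|
      ≤ 2 * σ := by
  have hσ : 0 ≤ σ := (abs_nonneg _).trans (hs 0)
  intro n
  induction n with
  | zero => intro k; simpa using hσ
  | succ n ih =>
    intro k
    rw [Function.iterate_succ_apply']
    have h := map_abs_le (s := s) hCm hθ0 hθ1 hw0 hwanti hwS hc hv ih k
    have h2 : Cm * S / (2 * (1 - θ)) * (2 * σ) ≤ 1 / 2 * (2 * σ) := mul_le_mul_of_nonneg_right hq (by positivity)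
    linarith [hs k]

/-- CONSECUTIVE PICARD ITERATES: `|(T^{n+1} 0)_k − (T^n 0)_k| ≤ σ·q^n`, `q = C_mS∕(2(1−θ))`. [folklore] -/
theorem iterate_step_abs_le {Cm θ S σ : ℝ} {w : ℕ → ℝ} {c : ℕ → ℕ → ℝ} {v s : ℕ → ℝ} (hCm : 0 ≤ Cm) (hθ0 : 0 ≤ θ) (hθ1 : θ < 1)
    (hw0 : ∀ q, 0 ≤ w q) (hwanti : ∀ {a b : ℕ}, a ≤ b → w b ≤ w a) (hwS : ∀ m, ∑ q ∈ range (m + 1), w q ≤ S)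
    (hc : ∀ p j, |c p j| ≤ Cm * θ ^ j) (hv : ∀ q, |v q| ≤ w q / 2) (hs : ∀ k, |s k| ≤ σ) (hq : Cm * S / (2 * (1 - θ)) ≤ 1 / 2) :
    ∀ n k, |((fun W : ℕ → ℝ => fun k => s k - ∑ p ∈ range k, ∑' j, c p j * v (p + 1 + j) * W (p + 1 + j))^[n + 1] (fun _ => 0) k)
      - ((fun W : ℕ → ℝ => fun k => s k - ∑ p ∈ range k, ∑' j, c p j * v (p + 1 + j) * W (p + 1 + j))^[n] (fun _ => 0) k)|
      ≤ σ * (Cm * S / (2 * (1 - θ))) ^ n := by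
  intro n
  induction n with
  | zero =>
    intro k
    simp only [zero_add, Function.iterate_one, Function.iterate_zero_apply, pow_zero, mul_one, mul_zero, tsum_zero,
      Finset.sum_const_zero, sub_zero]
    exact hs k
  | succ n ih =>
    intro k
    set T : (ℕ → ℝ) → ℕ → ℝ := fun W => fun k => s k - ∑ p ∈ range k, ∑' j, c p j * v (p + 1 + j) * W (p + 1 + j) with hT
    have e1 : T^[n + 1 + 1] (fun _ => 0) k = s k - ∑ p ∈ range k, ∑' j, c p j * v (p + 1 + j) * (T^[n + 1] (fun _ => 0)) (p + 1 + j) := by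
      rw [Function.iterate_succ_apply']
    have e2 : T^[n + 1] (fun _ => 0) k = s k - ∑ p ∈ range k, ∑' j, c p j * v (p + 1 + j) * (T^[n] (fun _ => 0)) (p + 1 + j) := by
      rw [Function.iterate_succ_apply']
    rw [e1, e2]
    have hb1 := iterate_abs_le hCm hθ0 hθ1 hw0 hwanti hwS hc hv hs hq (n + 1)
    have hb0 := iterate_abs_le hCm hθ0 hθ1 hw0 hwanti hwS hc hv hs hq n
    have h := map_sub_abs_le (s := s) hCm hθ0 hθ1 hw0 hwanti hwS hc hv hb1 hb0 ih k
    calc _ ≤ Cm * S / (2 * (1 - θ)) * (σ * (Cm * S / (2 * (1 - θ))) ^ n) := h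
      _ = σ * (Cm * S / (2 * (1 - θ))) ^ (n + 1) := by ring

/-- **THE PICARD ITERATES CONVERGE AT EVERY SCALE** (geometric Cauchy sequences in ℝ), the limit is bounded by 2σ and `σq^n∕(1−q)`-close to the n-th iterate. [folklore] -/
theorem iterate_tendsto {Cm θ S σ : ℝ} {w : ℕ → ℝ} {c : ℕ → ℕ → ℝ} {v s : ℕ → ℝ} (hCm : 0 ≤ Cm) (hθ0 : 0 ≤ θ) (hθ1 : θ < 1)
    (hw0 : ∀ q, 0 ≤ w q) (hwanti : ∀ {a b : ℕ}, a ≤ b → w b ≤ w a) (hwS : ∀ m, ∑ q ∈ range (m + 1), w q ≤ S)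
    (hc : ∀ p j, |c p j| ≤ Cm * θ ^ j) (hv : ∀ q, |v q| ≤ w q / 2) (hs : ∀ k, |s k| ≤ σ) (hq : Cm * S / (2 * (1 - θ)) ≤ 1 / 2) :
    ∃ W : ℕ → ℝ,
      (∀ k, Tendsto (fun n => ((fun W : ℕ → ℝ => fun k => s k - ∑ p ∈ range k, ∑' j, c p j * v (p + 1 + j) * W (p + 1 + j))^[n]
        (fun _ => 0) k)) atTop (𝓝 (W k))) ∧
      (∀ k, |W k| ≤ 2 * σ) ∧
      ∀ n k, |((fun W : ℕ → ℝ => fun k => s k - ∑ p ∈ range k, ∑' j, c p j * v (p + 1 + j) * W (p + 1 + j))^[n] (fun _ => 0) k) - W k|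
        ≤ σ * (Cm * S / (2 * (1 - θ))) ^ n / (1 - Cm * S / (2 * (1 - θ))) := by
  set T : (ℕ → ℝ) → ℕ → ℝ := fun W => fun k => s k - ∑ p ∈ range k, ∑' j, c p j * v (p + 1 + j) * W (p + 1 + j) with hT
  have hq1 : Cm * S / (2 * (1 - θ)) < 1 := by linarith
  have hstep : ∀ k n, dist (T^[n] (fun _ => 0) k) (T^[n + 1] (fun _ => 0) k) ≤ σ * (Cm * S / (2 * (1 - θ))) ^ n := by
    intro k n
    rw [dist_comm, Real.dist_eq]
    exact iterate_step_abs_le hCm hθ0 hθ1 hw0 hwanti hwS hc hv hs hq n k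
  have hcau : ∀ k, CauchySeq fun n => T^[n] (fun _ => 0) k := fun k =>
    cauchySeq_of_le_geometric (Cm * S / (2 * (1 - θ))) σ hq1 (hstep k)
  choose W hW using fun k => cauchySeq_tendsto_of_complete (hcau k)
  refine ⟨W, hW, fun k => ?_, fun n k => ?_⟩
  · exact le_of_tendsto ((continuous_abs.tendsto _).comp (hW k))
      (Eventually.of_forall fun n => iterate_abs_le hCm hθ0 hθ1 hw0 hwanti hwS hc hv hs hq n k)
  · have h := dist_le_of_le_geometric_of_tendsto (Cm * S / (2 * (1 - θ))) σ hq1 (hstep k) (hW k) n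
    rwa [Real.dist_eq] at h

/-! ## §109 The bounded fixed point: existence, Lipschitz dependence on the data, uniqueness -/

/-- **EXISTENCE OF A BOUNDED SOLUTION OF THE LINEAR MEMORY EQUATION.**  `|c_{p,j}| ≤ C_mθ^j`, `|v_q| ≤ w_q∕2` (w ≥ 0 antitone, partial sums ≤ S), `|s_k| ≤ σ`,
`C_mS∕(2(1−θ)) ≤ 1∕2` ⟹ there is W with **`W_k = s_k − Σ_{p<k} Σ_j c_{p,j} v_{p+1+j} W_{p+1+j}`** for every k and `|W_k| ≤ 2σ` (the scale-wise limit of the Picard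
iterates; the operator passes to the limit by Tannery's theorem row by row). [folklore] -/
theorem fixedPoint_exists {Cm θ S σ : ℝ} {w : ℕ → ℝ} {c : ℕ → ℕ → ℝ} {v s : ℕ → ℝ} (hCm : 0 ≤ Cm) (hθ0 : 0 ≤ θ) (hθ1 : θ < 1)
    (hw0 : ∀ q, 0 ≤ w q) (hwanti : ∀ {a b : ℕ}, a ≤ b → w b ≤ w a) (hwS : ∀ m, ∑ q ∈ range (m + 1), w q ≤ S)
    (hc : ∀ p j, |c p j| ≤ Cm * θ ^ j) (hv : ∀ q, |v q| ≤ w q / 2) (hs : ∀ k, |s k| ≤ σ) (hq : Cm * S / (2 * (1 - θ)) ≤ 1 / 2) :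
    ∃ W : ℕ → ℝ, (∀ k, W k = s k - ∑ p ∈ range k, ∑' j, c p j * v (p + 1 + j) * W (p + 1 + j)) ∧ ∀ k, |W k| ≤ 2 * σ := by
  obtain ⟨W, hT, hWb, -⟩ := iterate_tendsto hCm hθ0 hθ1 hw0 hwanti hwS hc hv hs hq
  set T : (ℕ → ℝ) → ℕ → ℝ := fun W => fun k => s k - ∑ p ∈ range k, ∑' j, c p j * v (p + 1 + j) * W (p + 1 + j) with hTdef
  refine ⟨W, fun k => ?_, hWb⟩
  have hσ : 0 ≤ σ := (abs_nonneg _).trans (hs 0)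
  -- the (n+1)-st iterate at scale k is T applied to the n-th iterate
  have h1 : Tendsto (fun n => T^[n + 1] (fun _ => 0) k) atTop (𝓝 (W k)) := (hT k).comp (tendsto_add_atTop_nat 1)
  have h2 : Tendsto (fun n => T^[n + 1] (fun _ => 0) k) atTop
      (𝓝 (s k - ∑ p ∈ range k, ∑' j, c p j * v (p + 1 + j) * W (p + 1 + j))) := by
    have hrow : ∀ p ∈ range k, Tendsto (fun n => ∑' j, c p j * v (p + 1 + j) * (T^[n] (fun _ => 0)) (p + 1 + j)) atTop
        (𝓝 (∑' j, c p j * v (p + 1 + j) * W (p + 1 + j))) := by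
      intro p _
      refine tendsto_tsum_of_dominated_convergence (bound := fun j => (Cm * (w (p + 1) * (2 * σ / 2))) * θ ^ j)
        ((summable_geometric_of_lt_one hθ0 hθ1).mul_left _) (fun j => ((hT (p + 1 + j)).const_mul _)) (Eventually.of_forall fun n j => ?_)
      rw [Real.norm_eq_abs]
      calc |c p j * v (p + 1 + j) * (T^[n] (fun _ => 0)) (p + 1 + j)| ≤ Cm * θ ^ j * (w (p + 1 + j) * (2 * σ / 2)) :=
            abs_term_le hCm hθ0 hc hv (iterate_abs_le hCm hθ0 hθ1 hw0 hwanti hwS hc hv hs hq n) p j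
        _ ≤ Cm * θ ^ j * (w (p + 1) * (2 * σ / 2)) :=
            mul_le_mul_of_nonneg_left (mul_le_mul_of_nonneg_right (hwanti (by omega)) (by positivity)) (by positivity)
        _ = (Cm * (w (p + 1) * (2 * σ / 2))) * θ ^ j := by ring
    have hsum := tendsto_finsetSum (range k) hrow
    have h3 := hsum.const_sub (s k)
    refine h3.congr fun n => ?_
    rw [Function.iterate_succ_apply']
  exact tendsto_nhds_unique h1 h2

/-- **LIPSCHITZ DEPENDENCE OF THE BOUNDED SOLUTION ON THE DATA** (the one estimate parts 67–68 use three times).  Two linear memory equations with data (c, v, s) and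
(c′, v′, s′) under the standing bounds, bounded solutions W (by M) and W′ (by M′); sources σ₁-close (`|s_k − s′_k| ≤ σ₁`) and kernels η-close in the profile sense
(`|c_{p,j}v_{p+1+j} − c′_{p,j}v′_{p+1+j}| ≤ C_mθ^j·w_{p+1+j}·η`).  THEN at every scale
**`|W_k − W′_k| ≤ (σ₁ + C_mS·ηM′∕(1−θ)) ∕ (1 − C_mS∕(2(1−θ)))`** (node U2's `le_of_affine_contraction` closes the sup-norm bootstrap). [folklore] -/
theorem fixedPoint_perturb {Cm θ S σ₁ η M M' : ℝ} {w : ℕ → ℝ} {c c' : ℕ → ℕ → ℝ} {v v' s s' W W' : ℕ → ℝ}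
    (hCm : 0 ≤ Cm) (hθ0 : 0 ≤ θ) (hθ1 : θ < 1)
    (hw0 : ∀ q, 0 ≤ w q) (hwanti : ∀ {a b : ℕ}, a ≤ b → w b ≤ w a) (hwS : ∀ m, ∑ q ∈ range (m + 1), w q ≤ S)
    (hq : Cm * S / (2 * (1 - θ)) ≤ 1 / 2)
    (hc : ∀ p j, |c p j| ≤ Cm * θ ^ j) (hv : ∀ q, |v q| ≤ w q / 2) (hc' : ∀ p j, |c' p j| ≤ Cm * θ ^ j) (hv' : ∀ q, |v' q| ≤ w q / 2)
    (hW : ∀ k, W k = s k - ∑ p ∈ range k, ∑' j, c p j * v (p + 1 + j) * W (p + 1 + j)) (hWM : ∀ q, |W q| ≤ M)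
    (hW' : ∀ k, W' k = s' k - ∑ p ∈ range k, ∑' j, c' p j * v' (p + 1 + j) * W' (p + 1 + j)) (hWM' : ∀ q, |W' q| ≤ M')
    (hss' : ∀ k, |s k - s' k| ≤ σ₁) (hη : 0 ≤ η)
    (hE : ∀ p j, |c p j * v (p + 1 + j) - c' p j * v' (p + 1 + j)| ≤ Cm * θ ^ j * (w (p + 1 + j) * η)) :
    ∀ k, |W k - W' k| ≤ (σ₁ + Cm * S * (η * M') / (1 - θ)) / (1 - Cm * S / (2 * (1 - θ))) := by
  have h1θ : 0 < 1 - θ := by linarith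
  have hM : 0 ≤ M := (abs_nonneg _).trans (hWM 0)
  have hM' : 0 ≤ M' := (abs_nonneg _).trans (hWM' 0)
  have hσ₁ : 0 ≤ σ₁ := (abs_nonneg _).trans (hss' 0)
  have hS : 0 ≤ S := (Finset.sum_nonneg fun q _ => hw0 q).trans (hwS 0)
  have hq0 : 0 ≤ Cm * S / (2 * (1 - θ)) := by positivity
  have hq1 : Cm * S / (2 * (1 - θ)) < 1 := by linarith
  have hA : 0 ≤ σ₁ + Cm * S * (η * M') / (1 - θ) := by positivity
  refine le_of_affine_contraction (δ := fun i => |W i - W' i|) (γ₀ := M + M') hq0 hq1 hA (fun i => ?_) (fun D hD i => ?_)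
  · calc |W i - W' i| ≤ |W i| + |W' i| := abs_sub _ _
      _ ≤ M + M' := add_le_add (hWM i) (hWM' i)
  · have hD0 : 0 ≤ D := (abs_nonneg _).trans (hD 0)
    -- summability of both rows
    have hsW : ∀ p, Summable fun j => c p j * v (p + 1 + j) * W (p + 1 + j) := term_summable hCm hθ0 hθ1 hwanti hc hv hWM
    have hsW' : ∀ p, Summable fun j => c' p j * v' (p + 1 + j) * W' (p + 1 + j) := term_summable hCm hθ0 hθ1 hwanti hc' hv' hWM'
    -- the mixed row: c v W − c′ v′ W′ = c v (W − W′) + (c v − c′ v′) W′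
    have hF : ∀ p j, |c p j * v (p + 1 + j) * W (p + 1 + j) - c' p j * v' (p + 1 + j) * W' (p + 1 + j)|
        ≤ Cm * θ ^ j * (w (p + 1 + j) * (D / 2 + η * M')) := by
      intro p j
      have e : c p j * v (p + 1 + j) * W (p + 1 + j) - c' p j * v' (p + 1 + j) * W' (p + 1 + j)
          = c p j * v (p + 1 + j) * (W (p + 1 + j) - W' (p + 1 + j))
            + (c p j * v (p + 1 + j) - c' p j * v' (p + 1 + j)) * W' (p + 1 + j) := by ring
      rw [e]
      have h1 : |c p j * v (p + 1 + j) * (W (p + 1 + j) - W' (p + 1 + j))| ≤ Cm * θ ^ j * (w (p + 1 + j) * (D / 2)) :=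
        abs_term_le (W := fun q => W q - W' q) hCm hθ0 hc hv hD p j
      have h2 : |(c p j * v (p + 1 + j) - c' p j * v' (p + 1 + j)) * W' (p + 1 + j)| ≤ Cm * θ ^ j * (w (p + 1 + j) * η) * M' := by
        rw [abs_mul]
        exact mul_le_mul (hE p j) (hWM' _) (abs_nonneg _) (by have := hw0 (p + 1 + j); positivity)
      calc _ ≤ |c p j * v (p + 1 + j) * (W (p + 1 + j) - W' (p + 1 + j))|
            + |(c p j * v (p + 1 + j) - c' p j * v' (p + 1 + j)) * W' (p + 1 + j)| := abs_add_le _ _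
        _ ≤ Cm * θ ^ j * (w (p + 1 + j) * (D / 2)) + Cm * θ ^ j * (w (p + 1 + j) * η) * M' := add_le_add h1 h2
        _ = Cm * θ ^ j * (w (p + 1 + j) * (D / 2 + η * M')) := by ring
    have hk := kernel_abs_le hθ0 hθ1 hw0 hwanti hwS (by positivity : 0 ≤ D / 2 + η * M') hCm hF i
    have hdiff : W i - W' i = (s i - s' i) - ∑ p ∈ range i, ∑' j,
        (c p j * v (p + 1 + j) * W (p + 1 + j) - c' p j * v' (p + 1 + j) * W' (p + 1 + j)) := by
      rw [hW i, hW' i]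
      have : ∑ p ∈ range i, ∑' j, (c p j * v (p + 1 + j) * W (p + 1 + j) - c' p j * v' (p + 1 + j) * W' (p + 1 + j))
          = ∑ p ∈ range i, ∑' j, c p j * v (p + 1 + j) * W (p + 1 + j) - ∑ p ∈ range i, ∑' j, c' p j * v' (p + 1 + j) * W' (p + 1 + j) := by
        rw [← Finset.sum_sub_distrib]
        exact Finset.sum_congr rfl fun p _ => (hsW p).tsum_sub (hsW' p)
      rw [this]; ring
    have e : Cm * S * (D / 2 + η * M') / (1 - θ) = Cm * S * (η * M') / (1 - θ) + Cm * S / (2 * (1 - θ)) * D := by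
      field_simp
      ring
    rw [hdiff]
    calc |s i - s' i - ∑ p ∈ range i, ∑' j, (c p j * v (p + 1 + j) * W (p + 1 + j) - c' p j * v' (p + 1 + j) * W' (p + 1 + j))|
        ≤ |s i - s' i| + |∑ p ∈ range i, ∑' j, (c p j * v (p + 1 + j) * W (p + 1 + j) - c' p j * v' (p + 1 + j) * W' (p + 1 + j))| :=
          abs_sub _ _
      _ ≤ σ₁ + Cm * S * (D / 2 + η * M') / (1 - θ) := add_le_add (hss' i) hk
      _ = σ₁ + Cm * S * (η * M') / (1 - θ) + Cm * S / (2 * (1 - θ)) * D := by rw [e]; ring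

/-- **UNIQUENESS OF THE BOUNDED SOLUTION** of the linear memory equation (same data, any two bounded solutions coincide). [folklore] -/
theorem fixedPoint_unique {Cm θ S M M' : ℝ} {w : ℕ → ℝ} {c : ℕ → ℕ → ℝ} {v s W W' : ℕ → ℝ}
    (hCm : 0 ≤ Cm) (hθ0 : 0 ≤ θ) (hθ1 : θ < 1)
    (hw0 : ∀ q, 0 ≤ w q) (hwanti : ∀ {a b : ℕ}, a ≤ b → w b ≤ w a) (hwS : ∀ m, ∑ q ∈ range (m + 1), w q ≤ S)
    (hq : Cm * S / (2 * (1 - θ)) ≤ 1 / 2) (hc : ∀ p j, |c p j| ≤ Cm * θ ^ j) (hv : ∀ q, |v q| ≤ w q / 2)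
    (hW : ∀ k, W k = s k - ∑ p ∈ range k, ∑' j, c p j * v (p + 1 + j) * W (p + 1 + j)) (hWM : ∀ q, |W q| ≤ M)
    (hW' : ∀ k, W' k = s k - ∑ p ∈ range k, ∑' j, c p j * v (p + 1 + j) * W' (p + 1 + j)) (hWM' : ∀ q, |W' q| ≤ M') :
    W = W' := by
  funext k
  have h := fixedPoint_perturb (σ₁ := 0) (η := 0) hCm hθ0 hθ1 hw0 hwanti hwS hq hc hv hc hv hW hWM hW' hWM' (fun k => by simp) le_rfl
    (fun p j => by have := hw0 (p + 1 + j); simp) k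
  have : (0 + Cm * S * (0 * M') / (1 - θ)) / (1 - Cm * S / (2 * (1 - θ))) = 0 := by simp
  rw [this] at h
  exact eq_of_abs_sub_nonpos h

end

end Summit.QuantumFields.BalabanUV.Beta.EriceFlowEnclosureB12AsPrintedHistoryContagionShiftFlowZeroTangent
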